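import Mathlib

/-!
# SoloBlindWeylDivisibility — the structural (all-host) lock T0(5):
# `[K : K_cm]` divides `|W(Δ_λ)|`, the Weyl group of the centraliser of the archimedean
# infinitesimal character, for every non-abelian functorial transfer to ANY host

Solo seat `solo-Langlands-blind`, session 12.  `SoloBlindFunctorialLock` (T0(4)) bounds a
Hodge–Tate MULTIPLICITY of every transfer `r ∘ ρ_π` into some `GL_N`; it is silent about hosts that
are not read through a representation (exceptional Shimura varieties of types `E₆`, `E₇`, spin and
trialitarian hosts, `A`-parameters).  The present file is the target-free form of the lock: the
obstruction lives in the WEYL GROUP OF THE CENTRALISER of the archimedean infinitesimal character,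
for an arbitrary complex reductive host `Ĥ`.  Only the finite-group skeleton is formalised; the
module docstring is the dictionary saying which published theorem discharges which hypothesis.

## The arithmetic statement (T0(5))

Setting.  `K` a number field, `K_cm ⊆ K` its maximal totally-real-or-CM subfield,
`m := [K : K_cm]`; `π` a cuspidal REGULAR ALGEBRAIC representation of `GL_n(𝔸_K)`, `n ≥ 2`;
`E := Hom(K, ℚ̄)`, `Ĝ := GL_n(ℂ)^E` the neutral component of `ᴸ(Res_{K/ℚ} GL_n)`, on which `Γ_ℚ`
acts by permuting `E`; `M` the Galois closure of `K_cm` (totally real or CM).  HOST: `H` a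
connected reductive group over `ℚ` whose `*`-action of `Γ_ℚ` on the Dynkin diagram of `H^{ad}`
becomes trivial over a totally real or CM Galois field `E_H` — automatic when `H` carries a Shimura
datum (every complex conjugation acts on the based root datum of `H^{ad}` by the opposition
involution, which is central in `Aut(Dyn)`, so `E_H` is totally real or CM), and true for
`H = Res_{F/ℚ} GL_N`, `F` totally real or CM (T0(4)).  Put `M'' := M · E_H` (Galois, totally real
or CM), `Γ'' := Gal(ℚ̄/M'')`.  Replacing `Ĥ` by `Ĥ/Z(Ĥ)` changes neither the roots, nor `Δ_λ`
below, nor non-abelianness (`ξ(SL_n^E)` is perfect, so it is central only if trivial), so we may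
and do assume `Γ''` acts trivially on `Ĥ`; an `L`-homomorphism `ᴸ(Res_{K/ℚ} GL_n)|_{Γ''} → ᴸH|_{Γ''}`
is then a homomorphism `ξ : Ĝ ⋊ Γ'' → Ĥ`.  Assume `ξ|_Ĝ` NON-ABELIAN: it does not factor through
`det^E : Ĝ → (ℂ^×)^E`.  (The `A`-parameter version `(Ĝ ⋊ Γ'') × SL₂(ℂ) → Ĥ` is covered verbatim:
replace `λ_H` by the infinitesimal character of the `A`-parameter.)  Let `φ_∞ : W_ℝ → Ĝ ⋊ Γ_ℚ` be
the archimedean `L`-parameter of `π` (Langlands classification for `GL_n(K ⊗ ℝ)`); `W_ℂ = ℂ^×`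
maps to `Ĝ`, and after `Ĝ`-conjugation `φ_∞(z) = (diag(z^{a_{x,i}} z̄^{b_{x,i}})_i)_{x ∈ E} ∈ T̂_G`,
the diagonal torus, with the REGULAR infinity type `a_x = (a_{x,1} > … > a_{x,n})` at `x` and
`b_{x,i} = w − a_{x,i}` (Clozel purity).  Let `φ_H := ξ ∘ φ_∞`, choose a maximal torus
`T̂_H ⊇ S := ξ(T̂_G) ⊇ φ_H(ℂ^×)`, write `φ_H(e^s) = exp(s λ_H + s̄ μ_H)` (`λ_H, μ_H ∈ Lie T̂_H`,
the archimedean infinitesimal character is `λ_H`), and put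
`Δ_λ := {α ∈ Φ(Ĥ, T̂_H) : ⟨α, λ_H⟩ = 0}`, `L̂ := Cent_Ĥ(λ_H)` (connected: a Levi subgroup with root
system `Δ_λ` and Weyl group `W(Δ_λ)`).

THEOREM T0(5).  `m ∣ |W(Δ_λ)|`.  Hence if `m ≥ 2` the infinitesimal character `λ_H` of every
functorial transfer of `π` to `H` is SINGULAR, and if `3 ∣ m` then `W(Δ_λ)` contains an element of
order `3`, so `Δ_λ` is not of type `A₁^k`.

Proof.  (i) CM-DESCENT (`SoloBlindCMDescent`, `SoloBlindParallelType`: Clozel purity + Patrikis):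
the infinity type `a_x` depends only on `x|_{K_cm}`, hence is constant on `Γ''`-orbits in `E`
(`Γ''` fixes `M ⊇ x(K_cm)` pointwise).  Since `(1 ⋊ γ) t (1 ⋊ γ)⁻¹ = γ(t)` with
`γ(t)_x = t_{γ⁻¹x}`, we get `γ(φ_∞(z)) = φ_∞(z)` for `γ ∈ Γ''`, `z ∈ ℂ^×`.  Consequently
`n_γ := ξ(1 ⋊ γ)` centralises `φ_H(ℂ^×)`, hence its Zariski closure, a torus whose (complex) Lie
algebra contains `λ_H + μ_H` and `i(λ_H − μ_H)`, hence `λ_H`: so `Ad(n_γ) λ_H = λ_H`, i.e.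
`n_γ ∈ L̂`.  Likewise `S = ξ(T̂_G)` is a torus with `λ_H ∈ Lie S`, so `S ⊆ L̂`, and `n_γ`
normalises `S` because `γ` normalises `T̂_G`.  Let `A` be the image of `Γ''` in
`N_{L̂}(S)/C_{L̂}(S)`.  Rigidity of tori: with `T̂_H` chosen inside `C_{L̂}(S)` (possible: `S` is
central in the connected reductive group `C_{L̂}(S)`), every coset of `N_{L̂}(S)/C_{L̂}(S)` meets
`N_{L̂}(T̂_H)` (conjugacy of maximal tori of `C_{L̂}(S)`), so
`N_{L̂}(S)/C_{L̂}(S) ≅ Stab_{W(L̂)}(S)/Fix_{W(L̂)}(S)`: `A` is a SUBQUOTIENT of `W(L̂) = W(Δ_λ)` —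
hypotheses `N`, `f`, `hf` of `structuralLock` (`N` = preimage of `A` in `Stab_W(S)`, `f` = the
quotient map).
(ii) THE PERMUTATION ACTION FACTORS THROUGH `A`.  `Γ''` permutes `E`, and every `Γ''`-orbit has
exactly `m` elements (`|Γ'' x| = [x(K) : x(K) ∩ M''] = [K : K_cm]`, because subfields of `M''` are
totally real or CM and `M''/ℚ` is Galois; dictionary of `SoloBlindFunctorialLock`).  Call a slot
`x ∈ E` dead if `SL_n^{(x)} ⊆ 𝒦 := ker ξ ∩ Ĝ`; `𝒦` is normal in `Ĝ` and `Γ''`-stable, so deadness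
is a property of orbits, and not every orbit is dead (else `SL_n^E ⊆ ker ξ` and `ξ|_Ĝ` factors
through `det^E`).  Fix a live orbit `O`.  If `γ ∈ Γ''` maps to `1 ∈ A`, then `n_γ ∈ C_{L̂}(S)`, so
`ξ(γ(t)) = n_γ ξ(t) n_γ⁻¹ = ξ(t)` for all `t ∈ T̂_G`.  Suppose `γ x = y ≠ x` with `x ∈ O`; take `t`
with a diagonal entry `d` at slot `x`, `d` having two eigenvalues with ratio `≠ ±1`, and `1`
elsewhere.  Then `u := t⁻¹ γ(t) = (d⁻¹ at x, d at y) ∈ 𝒦`, and for `g ∈ GL_n^{(x)}` the commutator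
`[g, u] ∈ 𝒦` is supported at slot `x` with entry `g d⁻¹ g⁻¹ d`, non-central for a suitable
permutation matrix `g`.  A normal subgroup of `GL_n(ℂ)` (`n ≥ 2`) with a non-central element
contains `SL_n(ℂ)` (commutators with `SL_n`, perfectness of `SL_n(ℂ)`, simplicity of `PSL_n(ℂ)`),
so `SL_n^{(x)} ⊆ 𝒦`: `x` is dead — contradiction.  Hence `ker(Γ'' → A)` fixes `O` pointwise:
hypotheses `q`, `hq` of `structuralLock`, with `Γ''` acting transitively on `O`, `Nat.card O = m`.
(iii) COUNT (`structuralLock`): `m = [Γ'' : Stab(x)] ∣ [Γ'' : ker q] = |q(Γ'')| ∣ |A| ∣ |N| ∣ |W(Δ_λ)|`.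

## Corollaries (dictionary to cohomology; not formalised)

(a) `m ≥ 2 ⇒ W(Δ_λ) ≠ 1 ⇒ Δ_λ ≠ ∅ ⇒ λ_H` singular (`nontrivial_of_two_le_card`): no transfer of
    `π` to any such host is discrete series / cohomological at infinity (cohomological
    representations have the regular infinitesimal character of a finite-dimensional
    representation), on any real form, for any local system, for `L`- and `A`-parameters alike.
    For `Ĥ = GL_N` this is the qualitative content of T0(4); T0(5) adds the exceptional, spin and
    trialitarian hosts.
(b) `3 ∣ m` — every `K` containing a complex cubic field (`SoloBlindCubicField`), in particular the
    `−23` cubic field itself (`m = 3`) — ⇒ `W(Δ_λ)` has an element of order `3`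
    (`exists_orderOf_eq_three`) ⇒ `W(Δ_λ)` is not generated by pairwise commuting involutions
    (`not_generated_by_commuting_involutions`) ⇒ `Δ_λ` is not of type `A₁^k`.  Now let `H_ℝ` be any
    real form with a compact Cartan subgroup and `π(λ', C)` (`λ' = wλ_H`) any limit of discrete
    series in the archimedean packet of `ξ ∘ φ_∞`.  If `π(λ', C)` were NON-DEGENERATE in the sense
    of Knapp–Zuckerman (`λ'` orthogonal to no compact root), all roots of `Δ_{λ'} = wΔ_λ` would be
    noncompact; for two of them `α ≠ ±β`, `α ± β` is never a root (it would lie in `Δ_{λ'}` and be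
    compact, `[𝔭, 𝔭] ⊆ 𝔨`), so `⟨α, β^∨⟩ = 0`
    (Mathlib: `RootPairing.pairingIn_eq_zero_of_add_notMem_of_sub_notMem`), `Δ_{λ'}` is of type
    `A₁^k` and `W(Δ_λ) ≅ (ℤ/2)^k` is generated by `k` commuting reflections — contradiction.  So for
    `3 ∣ m` NO member of the archimedean packet of any transfer, on any real form of any admissible
    host, is a non-degenerate limit of discrete series (consistent with [Gol11]: packets are
    uniformly (non-)degenerate); degenerate limits and more singular tempered parameters have no
    known realisation in the coherent or étale cohomology of any algebraic variety, and provably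
    none directly in a Shimura variety (Mirković [Mir88]; [Gol16, p. 357, §4.4.1]).  The lock is
    sharp where the known method works: for `m = 2` (the Boxer–Calegari–Gee–Pilloni regime)
    `Δ_λ = A₁`, `W = S₂` is allowed and the weight-2 non-degenerate limits on `GSp₄` exist; for
    `m = 3` and the hosts `GSp₆`, `GSpin(2,5)` one finds `Δ_λ = A₂`, `W = S₃` (first `example` below).
Scope, stated not hidden: (1) packet/tempered members only — non-tempered members of `A`-packets
are constrained through `λ_H` alone, via (a); (2) `M''` totally real or CM is USED twice (orbit
length `m`; triviality of the `L`-action) — for `H = Res_{K/ℚ} GL_n` itself `E_H = K^g` is not CM and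
indeed `ξ = id` transfers `π` regularly: the hypothesis is sharp; (3) `m = 2^j ≥ 4` is not excluded
by (b) (T0(4) still excludes every standard classical host; the trialitarian `D₄` host for quartic
`K`, `m = 4`, has `Δ_λ = 3A₁`, which is not a set of pairwise strongly orthogonal noncompact roots
of `so(6,2)`, real rank `2` — HOME/ATTEMPTS.md A45).

## Dictionary to the theorems below

* `W` = `W(Δ_λ)`;  `N ≤ W`, `f : N ↠ A` = step (i);  `Γ` = `Γ''` (index and `Nat.card` are used,
  so a profinite `Γ` or any finite quotient through which it acts will do);  `q : Γ →* A` =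
  `γ ↦ n_γ · C_{L̂}(S)`;  `O` = a live `Γ''`-orbit in `E`, `Nat.card O = m = [K : K_cm]`;
  `hq` = step (ii);
* `structuralLock : Nat.card O ∣ Nat.card W`;  `nontrivial_of_two_le_card` = corollary (a);
  `exists_orderOf_eq_three`, `not_generated_by_commuting_involutions` = corollary (b).

[cite: Clozel1990, Thm. 3.13, Lemme 4.9 (purity of regular algebraic cusp forms)]
[cite: Patrikis2019, Prop. 2.4.7 and §3.2 (arXiv:1207.6724, p. 24–25: CM descent of infinity types)]
[cite: KnappVogan1995, Thm. 11.178 and (11.190c), p. 716 (limits of discrete series `π(λ, C)`)]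
[cite: KnappZuckerman1982, §1 (non-degenerate limits: `λ` orthogonal to no compact root)]
[cite: Goldring2016 — W. Goldring, An introduction to the Langlands correspondence, in M. Kerr and
G. Pearlstein (eds.), Recent Advances in Hodge Theory, LMS Lecture Notes 427, CUP 2016, 333–367:
p. 348 (non-degeneracy; [Gol11] packets uniformly (non-)degenerate), p. 357 §4.4.1 (degenerate
limits: no known geometric realisation; Mirković)] [cite: Mirkovic1988] [cite: Deligne1979,
Variétés de Shimura, §1.2 (the conjugation action and the opposition involution)]
[cite: BuzzardGeeLMS2014, §2–3 (`L`-groups, infinity types, Hodge–Tate weights)]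
-/

namespace Summit.Langlands.Langlands.Theorems.SoloBlind

/-! ### Orbit–stabiliser and subquotients -/

section Divisibility

/-- A transitive action on a nonempty set has degree dividing the order of the acting group
(orbit–stabiliser; for an infinite group `Nat.card = 0` and the statement is trivial). -/
theorem card_dvd_card_of_isPretransitive (A O : Type*) [Group A] [MulAction A O]
    [MulAction.IsPretransitive A O] [Nonempty O] : Nat.card O ∣ Nat.card A := by
  obtain ⟨x⟩ := ‹Nonempty O›
  rw [← MulAction.index_stabilizer_of_transitive A x]
  exact Subgroup.index_dvd_card _

/-- The order of a subquotient divides the order of the group. -/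
theorem card_subquotient_dvd_card {W A : Type*} [Group W] [Group A] (N : Subgroup W)
    (f : N →* A) (hf : Function.Surjective f) : Nat.card A ∣ Nat.card W :=
  (Subgroup.card_dvd_of_surjective f hf).trans (Subgroup.card_subgroup_dvd_card N)

/-- If a transitive action of `Γ` on `O` factors through a homomorphism `q : Γ → A` (every element
of `ker q` acts trivially), then `|O|` divides the order of the image `q(Γ)`. -/
theorem card_dvd_card_range_of_factors {Γ A O : Type*} [Group Γ] [Group A] [MulAction Γ O]
    [MulAction.IsPretransitive Γ O] [Nonempty O] (q : Γ →* A)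
    (hq : ∀ γ : Γ, q γ = 1 → ∀ x : O, γ • x = x) : Nat.card O ∣ Nat.card q.range := by
  obtain ⟨x⟩ := ‹Nonempty O›
  have hle : q.ker ≤ MulAction.stabilizer Γ x := fun γ hγ =>
    MulAction.mem_stabilizer_iff.mpr (hq γ (MonoidHom.mem_ker.mp hγ) x)
  rw [← MulAction.index_stabilizer_of_transitive Γ x, ← Subgroup.index_ker q]
  exact Subgroup.index_dvd_of_le hle

/-- **The structural lock** (finite-group form of T0(5); dictionary in the module docstring).
`Γ` acts transitively on the orbit `O` (`|O| = m = [K : K_cm]`); the action factors through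
`q : Γ → A` (step (ii): an element acting trivially on the torus `S` fixes every live slot); and
`A` is a subquotient of `W = W(Δ_λ)` (step (i): `A ⊆ N_{L̂}(S)/C_{L̂}(S)`).  Then `m ∣ |W|`. -/
theorem structuralLock {Γ A W O : Type*} [Group Γ] [Group A] [Group W] [MulAction Γ O]
    [MulAction.IsPretransitive Γ O] [Nonempty O] (q : Γ →* A)
    (hq : ∀ γ : Γ, q γ = 1 → ∀ x : O, γ • x = x)
    (N : Subgroup W) (f : N →* A) (hf : Function.Surjective f) :
    Nat.card O ∣ Nat.card W :=
  ((card_dvd_card_range_of_factors q hq).trans (Subgroup.card_subgroup_dvd_card q.range)).trans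
    (card_subquotient_dvd_card N f hf)

/-- Corollary (a): if `m = |O| ≥ 2` then `W(Δ_λ)` is nontrivial, i.e. `Δ_λ ≠ ∅` and `λ_H` is
singular — no transfer is discrete series / cohomological at infinity. -/
theorem nontrivial_of_two_le_card {Γ A W O : Type*} [Group Γ] [Group A] [Group W] [Finite W]
    [MulAction Γ O] [MulAction.IsPretransitive Γ O] [Nonempty O] (q : Γ →* A)
    (hq : ∀ γ : Γ, q γ = 1 → ∀ x : O, γ • x = x)
    (N : Subgroup W) (f : N →* A) (hf : Function.Surjective f) (hO : 2 ≤ Nat.card O) :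
    Nontrivial W := by
  have hdvd := structuralLock q hq N f hf
  rw [← Finite.one_lt_card_iff_nontrivial]
  have hpos : 0 < Nat.card W := Nat.card_pos
  exact lt_of_lt_of_le hO (Nat.le_of_dvd hpos hdvd)

/-- Corollary (b), first half: if `3 ∣ m = |O|` then `W(Δ_λ)` has an element of order `3`
(Cauchy). -/
theorem exists_orderOf_eq_three {Γ A W O : Type*} [Group Γ] [Group A] [Group W] [Finite W]
    [MulAction Γ O] [MulAction.IsPretransitive Γ O] [Nonempty O] (q : Γ →* A)
    (hq : ∀ γ : Γ, q γ = 1 → ∀ x : O, γ • x = x)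
    (N : Subgroup W) (f : N →* A) (hf : Function.Surjective f) (h3 : 3 ∣ Nat.card O) :
    ∃ w : W, orderOf w = 3 :=
  exists_prime_orderOf_dvd_card' 3 (h3.trans (structuralLock q hq N f hf))

end Divisibility

/-! ### `W(A₁^k)` has exponent `2` -/

section Involutions

/-- A group generated by pairwise commuting involutions has exponent dividing `2`. -/
theorem mul_self_eq_one_of_closure_commuting_involutions {W : Type*} [Group W] (S : Set W)
    (hS : Subgroup.closure S = ⊤) (hinv : ∀ s ∈ S, s * s = 1)
    (hcomm : ∀ s ∈ S, ∀ t ∈ S, s * t = t * s) (w : W) : w * w = 1 := by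
  have hcl : IsMulCommutative (Subgroup.closure S) := Subgroup.isMulCommutative_closure hcomm
  have hw : w ∈ Subgroup.closure S := by rw [hS]; exact Subgroup.mem_top w
  induction hw using Subgroup.closure_induction with
  | mem x hx => exact hinv x hx
  | one => exact mul_one 1
  | mul x y hx hy ihx ihy =>
    have hxy : x * y = y * x := setLike_mul_comm hx hy
    calc x * y * (x * y) = x * (y * x) * y := by group
      _ = x * (x * y) * y := by rw [hxy]
      _ = (x * x) * (y * y) := by group
      _ = 1 := by rw [ihx, ihy, mul_one]
  | inv x hx ihx =>
    rw [← mul_inv_rev, ihx, inv_one]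

/-- An element of order `3` is not an involution. -/
theorem mul_self_ne_one_of_orderOf_eq_three {W : Type*} [Group W] {w : W} (hw : orderOf w = 3) :
    w * w ≠ 1 := by
  intro h
  have h2 : orderOf w ∣ 2 := orderOf_dvd_of_pow_eq_one (by rw [pow_two, h])
  rw [hw] at h2
  omega

/-- Corollary (b), second half: under the lock hypotheses with `3 ∣ |O|`, `W = W(Δ_λ)` is NOT
generated by pairwise commuting involutions; since `W(A₁^k)` is generated by its `k` pairwise
commuting simple reflections, `Δ_λ` is not of type `A₁^k` — so (Knapp–Zuckerman,
`SoloBlindNoncompactRoots`) no member of the archimedean packet is a non-degenerate limit of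
discrete series on any real form of the host. -/
theorem not_generated_by_commuting_involutions {Γ A W O : Type*} [Group Γ] [Group A] [Group W]
    [Finite W] [MulAction Γ O] [MulAction.IsPretransitive Γ O] [Nonempty O] (q : Γ →* A)
    (hq : ∀ γ : Γ, q γ = 1 → ∀ x : O, γ • x = x)
    (N : Subgroup W) (f : N →* A) (hf : Function.Surjective f) (h3 : 3 ∣ Nat.card O)
    (S : Set W) (hinv : ∀ s ∈ S, s * s = 1) (hcomm : ∀ s ∈ S, ∀ t ∈ S, s * t = t * s) :
    Subgroup.closure S ≠ ⊤ := by
  intro hS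
  obtain ⟨w, hw⟩ := exists_orderOf_eq_three q hq N f hf h3
  exact mul_self_ne_one_of_orderOf_eq_three hw
    (mul_self_eq_one_of_closure_commuting_involutions S hS hinv hcomm w)

end Involutions

/-! ### Non-vacuity: the hypotheses are met non-trivially (`m = 3`, `W = A = Γ = S₃`) -/

section Examples

/-- The symmetric group `S₃` acting on `Fin 3`, `q = f = id`, `N = ⊤`: the lock gives
`3 ∣ |S₃| = 6`, and `S₃` has an element of order `3` — the `m = 3` row of the sanity table
(`K` = the `−23` cubic field, host `GSp₆` / `GSpin(2,5)`: `Δ_λ = A₂`, `W = S₃`). -/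
example : ∃ w : Equiv.Perm (Fin 3), orderOf w = 3 := by
  refine exists_orderOf_eq_three (Γ := Equiv.Perm (Fin 3)) (A := Equiv.Perm (Fin 3))
    (W := Equiv.Perm (Fin 3)) (O := Fin 3) (MonoidHom.id _) (fun γ hγ x => by simp_all)
    ⊤ (Subgroup.topEquiv.toMonoidHom) (fun a => ⟨⟨a, Subgroup.mem_top a⟩, rfl⟩) ?_
  simp

/-- … whereas for `m = 2` nothing beyond nontriviality is forced: `W(A₁) = S₂` satisfies every
hypothesis with `|O| = 2` (the Boxer–Calegari–Gee–Pilloni regime: `Δ_λ = A₁` is allowed). -/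
example : Nat.card (Fin 2) ∣ Nat.card (Equiv.Perm (Fin 2)) :=
  structuralLock (Γ := Equiv.Perm (Fin 2)) (A := Equiv.Perm (Fin 2)) (O := Fin 2)
    (MonoidHom.id _) (fun γ hγ x => by simp_all) ⊤ (Subgroup.topEquiv.toMonoidHom)
    (fun a => ⟨⟨a, Subgroup.mem_top a⟩, rfl⟩)

end Examples

end Summit.Langlands.Langlands.Theorems.SoloBlind
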